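import Literature.Barriers.QuantumFields.FiniteTemperaturePolyakovDiagonalOdd
import HarnessLib

/-!
# Borgs–Seiler's diagonal bound `⟨|Tr u|²⟩ ≥ 1`: even temporal extent, and the discharge of
# `BorgsSeilerPolyakovDiagonal`

Companion to `FiniteTemperaturePolyakovDiagonalOdd.lean`. For an EVEN number `L₀ = 2n + 2` of
time layers the time reflection `θ t = −t` (`FiniteTemperature.timeReflect`) fixes the two
lattice hyperplanes `t = 0` and `t = n + 1`: the SHARED block `M` consists of the spatial links of
these two slices, the POSITIVE block `P` of the spatial links of the slices `1, …, n` and the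
time-like links from `t` to `t + 1` for `t ≤ n`, and there are no crossing links. The Polyakov
loop splits as `ρ(g_{L_0}) = ρ(H₊)ρ(H₋) = ρ(a)ᴴ ρ(b)` with `a = H₊⁻¹ = gfunE U`,
`b = gfunE (θU) = H₋` (`timeHolonomy_timeReflect`), the Wilson weight as
`e^{A(U)} e^{A(θU)} e^{J_M (mag₀ + mag_{n+1})}`, and reflection positivity in lattice planes
(`LatticeRP.integral_splice_mul_conj_comp_of_shared_nonneg` with `C = ∅`) gives
`∫ (|tr ρ(g_{L_0})|² − 1) e^{−S} ∏dg ≥ 0`, i.e. `G_L(0) ≥ 1`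
(`FiniteTemperature.one_le_polyakovCorrelation_zero_even`).

Together with the odd case this DISCHARGES the named fact
`Literature.Barriers.QuantumFields.BorgsSeilerPolyakovDiagonal`
(`BorgsSeilerPolyakovDiagonal_holds`): Borgs–Seiler's "easy bound" (III.23)
`G(0) = ⟨|Tr u|²⟩ ≥ 1` for the fundamental representations of `U(N)` (`N ≥ 1`) and `SU(N)`
(`N ≥ 2`), every `d`, every `L₀ ≥ 1`, every (even) spatial box and all `J_E, J_M > 0` — in fact
for every continuous unitary matrix representation with `N ≥ 1` and `J_E ≥ 0`. Of the two inputs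
of `FiniteTemperatureDeconfinement.of_infraredBound` only the infrared bound
`BorgsSeilerInfraredBound` (Lemma III.6 / Cor. III.7) remains.

References: C. Borgs, E. Seiler, Commun. Math. Phys. 91 (1983) 329–380, §III.1 (III.18),
(III.23)–(III.25) (p. 347); §II.2 (pp. 331–332). [BorgsSeiler1983]
-/

noncomputable section

open MeasureTheory Filter Topology
open scoped ComplexConjugate ComplexOrder
open Literature.MathematicalPhysics.QuantumFieldTheory (haarProbability)
open Literature.MathematicalPhysics.QuantumFieldTheory.LatticeRP (splice splice_apply piMeasure)
open Literature.MathematicalPhysics.QuantumLattice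

namespace Literature.Barriers.QuantumFields

namespace FiniteTemperature

/-! ### Arithmetic in `ℤ_{2n+2}` -/

section ZModEven

variable {n : ℕ}

/-- `2n + 2 = 0` in `ℤ_{2n+2}`: `(n+1) + (n+1) = 0`. [folklore] -/
theorem half_add_half (n : ℕ) :
    ((n + 1 : ℕ) : ZMod (2 * n + 2)) + ((n + 1 : ℕ) : ZMod (2 * n + 2)) = 0 := by
  rw [← Nat.cast_add, show n + 1 + (n + 1) = 2 * n + 2 by ring, ZMod.natCast_self]

/-- `−(n+1) = n+1` in `ℤ_{2n+2}`: the second lattice reflection plane is fixed. [folklore] -/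
theorem neg_half (n : ℕ) : (-((n + 1 : ℕ) : ZMod (2 * n + 2))) = ((n + 1 : ℕ) : ZMod (2 * n + 2)) := by
  linear_combination (-1 : ZMod (2 * n + 2)) * half_add_half n

/-- `(n+1 : ℤ_{2n+2}).val = n+1`. [folklore] -/
theorem val_natCast_half (n : ℕ) : ((n + 1 : ℕ) : ZMod (2 * n + 2)).val = n + 1 :=
  ZMod.val_cast_of_lt (by omega)

/-- For `1 ≤ t.val`, `(−t).val = 2n + 2 − t.val`. [folklore] -/
theorem val_neg_of_pos_even {t : ZMod (2 * n + 2)} (ht : 1 ≤ t.val) :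
    (-t).val = 2 * n + 2 - t.val := by
  rw [ZMod.neg_val]
  have ht0 : t ≠ 0 := by
    intro h; rw [h, ZMod.val_zero] at ht; omega
  rw [if_neg ht0]

/-- `(−1 − t).val = 2n + 1 − t.val` in `ℤ_{2n+2}`. [folklore] -/
theorem val_neg_one_sub_even (t : ZMod (2 * n + 2)) : (-1 - t).val = 2 * n + 1 - t.val := by
  have ht := ZMod.val_lt t
  have h1 : (-1 - t : ZMod (2 * n + 2)) = ((2 * n + 1 - t.val : ℕ) : ZMod (2 * n + 2)) := by
    have h2 : ((2 * n + 1 - t.val : ℕ) : ZMod (2 * n + 2)) + 1 + (t.val : ℕ) = 0 := by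
      have : ((2 * n + 1 - t.val : ℕ) : ZMod (2 * n + 2)) + 1 + (t.val : ℕ) =
          ((2 * n + 1 - t.val + 1 + t.val : ℕ) : ZMod (2 * n + 2)) := by push_cast; ring
      rw [this, show 2 * n + 1 - t.val + 1 + t.val = 2 * n + 2 by omega, ZMod.natCast_self]
    rw [ZMod.natCast_zmod_val] at h2
    linear_combination (-1 : ZMod (2 * n + 2)) * h2
  rw [h1, ZMod.val_cast_of_lt (by omega)]

/-- Injectivity of small natural numbers in `ℤ_{2n+2}`. [folklore] -/
theorem natCast_injective_of_lt_even {a b : ℕ} (ha : a < 2 * n + 2) (hb : b < 2 * n + 2)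
    (h : (a : ZMod (2 * n + 2)) = b) : a = b := by
  have := congrArg ZMod.val h
  rwa [ZMod.val_cast_of_lt ha, ZMod.val_cast_of_lt hb] at this

end ZModEven

/-! ### The blocks of links (even period) -/

section BlocksEven

variable {d n L : ℕ} [NeZero L]

variable (d n L) in
/-- The SHARED block: spatial links of the slices `t = 0` and `t = n + 1` (the two lattice
reflection planes). [folklore] -/
def evenShared : Finset (Site d (2 * n + 2) L × Dir d) :=
  Finset.univ.filter fun e => e.2 ≠ none ∧ (e.1.1 = 0 ∨ e.1.1 = ((n + 1 : ℕ) : ZMod (2 * n + 2)))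

variable (d n L) in
/-- The POSITIVE block: spatial links of the slices `1, …, n` and time-like links from `t` to
`t + 1` for `t ≤ n`. [folklore] -/
def evenPos : Finset (Site d (2 * n + 2) L × Dir d) :=
  Finset.univ.filter fun e => (e.2 ≠ none ∧ 1 ≤ e.1.1.val ∧ e.1.1.val ≤ n) ∨
    (e.2 = none ∧ e.1.1.val ≤ n)

/-- Membership in the shared block. [folklore] -/
@[simp] theorem mem_evenShared {e : Site d (2 * n + 2) L × Dir d} :
    e ∈ evenShared d n L ↔ e.2 ≠ none ∧ (e.1.1 = 0 ∨ e.1.1 = ((n + 1 : ℕ) : ZMod (2 * n + 2))) := by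
  simp [evenShared]

/-- Membership in the positive block. [folklore] -/
@[simp] theorem mem_evenPos {e : Site d (2 * n + 2) L × Dir d} :
    e ∈ evenPos d n L ↔ (e.2 ≠ none ∧ 1 ≤ e.1.1.val ∧ e.1.1.val ≤ n) ∨
      (e.2 = none ∧ e.1.1.val ≤ n) := by simp [evenPos]

/-- The shared and positive blocks are disjoint. [folklore] -/
theorem disjoint_evenShared_evenPos : Disjoint (evenShared d n L) (evenPos d n L) := by
  rw [Finset.disjoint_left]
  rintro ⟨⟨t, x⟩, μ⟩ hM hP
  simp only [mem_evenShared, mem_evenPos] at hM hP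
  rcases hP with ⟨-, h1, h2⟩ | ⟨h, -⟩
  · rcases hM.2 with h0 | h0
    · rw [h0, ZMod.val_zero] at h1; omega
    · rw [h0, val_natCast_half] at h2; omega
  · exact hM.1 h

/-- A spatial link at time `0` is shared. [folklore] -/
theorem mem_evenShared_zero (x : Fin d → ZMod L) (i : Fin d) :
    (((0 : ZMod (2 * n + 2)), x), some i) ∈ evenShared d n L := by simp

/-- A spatial link at time `n + 1` is shared. [folklore] -/
theorem mem_evenShared_half (x : Fin d → ZMod L) (i : Fin d) :
    ((((n + 1 : ℕ) : ZMod (2 * n + 2)), x), some i) ∈ evenShared d n L := by simp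

/-- A spatial link at a time `t` with `t.val ≤ n + 1` is shared or positive (as a member of
`P ∪ ∅ ∪ M`). [folklore] -/
theorem mem_union_of_val_le_even {t : ZMod (2 * n + 2)} (ht : t.val ≤ n + 1)
    (x : Fin d → ZMod L) (i : Fin d) :
    ((t, x), some i) ∈ evenPos d n L ∪ ∅ ∪ evenShared d n L := by
  rcases Nat.eq_zero_or_pos t.val with h0 | hpos
  · have : t = 0 := (ZMod.val_eq_zero t).1 h0
    subst this
    exact Finset.mem_union_right _ (mem_evenShared_zero x i)
  · rcases Nat.lt_or_ge t.val (n + 1) with hlt | hge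
    · exact Finset.mem_union_left _ (Finset.mem_union_left _
        (mem_evenPos.2 (Or.inl ⟨Option.some_ne_none i, hpos, Nat.lt_succ_iff.1 hlt⟩)))
    · have hv : t.val = n + 1 := le_antisymm ht hge
      have : t = ((n + 1 : ℕ) : ZMod (2 * n + 2)) := by
        rw [← ZMod.natCast_zmod_val t, hv]
      subst this
      exact Finset.mem_union_right _ (mem_evenShared_half x i)

/-- A spatial link at a small natural-number time is in `P ∪ ∅ ∪ M`. [folklore] -/
theorem natCast_some_mem_union_even {j : ℕ} (hj : j ≤ n + 1) (x : Fin d → ZMod L) (i : Fin d) :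
    ((((j : ℕ) : ZMod (2 * n + 2)), x), some i) ∈ evenPos d n L ∪ ∅ ∪ evenShared d n L :=
  mem_union_of_val_le_even (by rw [ZMod.val_cast_of_lt (by omega)]; exact hj) x i

/-- The same with the time written `j + 1`. [folklore] -/
theorem natCast_add_one_some_mem_union_even {j : ℕ} (hj : j + 1 ≤ n + 1) (x : Fin d → ZMod L)
    (i : Fin d) :
    ((((j : ℕ) : ZMod (2 * n + 2)) + 1, x), some i) ∈ evenPos d n L ∪ ∅ ∪ evenShared d n L := by
  have h := natCast_some_mem_union_even (d := d) (L := L) hj x i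
  push_cast at h
  exact h

/-- A time-like link from a small natural-number time `j ≤ n` is positive. [folklore] -/
theorem natCast_none_mem_union_even {j : ℕ} (hj : j ≤ n) (x : Fin d → ZMod L) :
    ((((j : ℕ) : ZMod (2 * n + 2)), x), none) ∈ evenPos d n L ∪ ∅ ∪ evenShared d n L :=
  Finset.mem_union_left _ (Finset.mem_union_left _ (mem_evenPos.2
    (Or.inr ⟨rfl, by
      show ((j : ℕ) : ZMod (2 * n + 2)).val ≤ n
      rw [ZMod.val_cast_of_lt (by omega)]; exact hj⟩)))

variable {G : Type*} [Group G]

/-- The reflection fixes the shared block (`−0 = 0`, `−(n+1) = n+1`). [folklore] -/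
theorem timeReflect_apply_of_mem_evenShared (U : Config d (2 * n + 2) L G)
    {e : Site d (2 * n + 2) L × Dir d} (he : e ∈ evenShared d n L) : timeReflect U e = U e := by
  rcases e with ⟨⟨t, x⟩, _ | i⟩
  · simp at he
  · simp only [mem_evenShared] at he
    rcases he.2 with h | h
    · rw [h, timeReflect_some, neg_zero]
    · rw [h, timeReflect_some, neg_half]

/-- The dependency condition: the `P`-coordinates of `θU` depend only on the coordinates of
`U` off `P`. [folklore] -/
theorem dependsOn_timeReflect_apply_even {e : Site d (2 * n + 2) L × Dir d}
    (he : e ∈ evenPos d n L ∪ ∅) :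
    DependsOn (fun U : Config d (2 * n + 2) L G => timeReflect U e)
      (((evenPos d n L)ᶜ : Finset _) : Set (Site d (2 * n + 2) L × Dir d)) := by
  rw [Finset.union_empty] at he
  intro U V hUV
  rcases e with ⟨⟨t, x⟩, _ | i⟩
  · simp only [timeReflect_none]
    rw [mem_evenPos] at he
    have ht : t.val ≤ n := by
      rcases he with ⟨h, -⟩ | ⟨-, h⟩
      · exact (h rfl).elim
      · exact h
    have hmem : (((-1 - t, x), none) : Site d (2 * n + 2) L × Dir d) ∈
        ((evenPos d n L)ᶜ : Finset _) := by
      rw [Finset.mem_compl, mem_evenPos]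
      rintro (⟨h, -⟩ | ⟨-, h⟩)
      · exact h rfl
      · change (-1 - t).val ≤ n at h
        rw [val_neg_one_sub_even] at h
        omega
    rw [hUV _ hmem]
  · simp only [timeReflect_some]
    rw [mem_evenPos] at he
    have hP : 1 ≤ t.val ∧ t.val ≤ n := by
      rcases he with ⟨-, h1, h2⟩ | ⟨h, -⟩
      · exact ⟨h1, h2⟩
      · exact (Option.some_ne_none i h).elim
    have hmem : (((-t, x), some i) : Site d (2 * n + 2) L × Dir d) ∈
        ((evenPos d n L)ᶜ : Finset _) := by
      rw [Finset.mem_compl, mem_evenPos]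
      rintro (⟨-, -, h2⟩ | ⟨h, -⟩)
      · change (-t).val ≤ n at h2
        rw [val_neg_of_pos_even hP.1] at h2; omega
      · exact (Option.some_ne_none i h).elim
    rw [hUV _ hmem]

end BlocksEven

/-! ### The observables of the even case -/

section Even

variable {d n L : ℕ} {G : Type*} [Group G] {N : ℕ}
variable (ρ : G →* Matrix (Fin N) (Fin N) ℂ)

/-- `gfunE U = H₊(U)⁻¹`, `H₊` the holonomy of the first `n + 1` time-like links at the spatial
origin; `ρ(g_{L_0}) = ρ(gfunE U)ᴴ ρ(gfunE θU)`. [folklore] -/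
def gfunE (U : Config d (2 * n + 2) L G) : G := (timeHolonomy U (n + 1) (0, 0))⁻¹

/-- The positive-side part of the exponent of the Wilson weight (even period):
`A(U) = J_E Σ_{j ≤ n} elec_j(U) + J_M Σ_{j<n} mag_{j+1}(U)`. [folklore] -/
def posExponentE [NeZero L] (JE JM : ℝ) (U : Config d (2 * n + 2) L G) : ℝ :=
  JE * ∑ j ∈ Finset.range (n + 1), elecSlice ρ (j : ZMod (2 * n + 2)) U +
    JM * ∑ j ∈ Finset.range n, magSlice ρ ((j + 1 : ℕ) : ZMod (2 * n + 2)) U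

/-- Half the plane part of the exponent: `J_M (mag₀(U) + mag_{n+1}(U)) / 2`. [folklore] -/
def planeExponentE [NeZero L] (JM : ℝ) (U : Config d (2 * n + 2) L G) : ℝ :=
  JM * (magSlice ρ 0 U + magSlice ρ ((n + 1 : ℕ) : ZMod (2 * n + 2)) U) / 2

/-- The observable `g_{pq}` of the even case. [folklore] -/
def gobsE [NeZero L] (JE JM : ℝ) (p q : Fin N × Fin N) (U : Config d (2 * n + 2) L G) : ℂ :=
  conj (fcoef N (ρ (gfunE U)) p q) * (Real.exp (posExponentE ρ JE JM U) : ℂ) *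
    (Real.exp (planeExponentE ρ JM U) : ℂ)

/-- `gfunE` on the reflected configuration is the second half `H₋` of the Polyakov loop. [folklore] -/
theorem gfunE_timeReflect (U : Config d (2 * n + 2) L G) :
    gfunE (timeReflect U) = timeHolonomy U (n + 1) ((((n + 1 : ℕ) : ZMod (2 * n + 2))), 0) := by
  unfold gfunE
  rw [timeHolonomy_timeReflect, inv_inv, neg_zero, zero_sub, neg_half]

/-- The Polyakov loop at the origin as first half · second half. [folklore] -/
theorem polyakovLine_zero_eq_even (V : Config d (2 * n + 2) L G) :
    polyakovLine V 0 = timeHolonomy V (n + 1) (0, 0) *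
      timeHolonomy V (n + 1) ((((n + 1 : ℕ) : ZMod (2 * n + 2))), 0) := by
  unfold polyakovLine
  have h : timeHolonomy V (2 * n + 2) ((0 : ZMod (2 * n + 2)), (0 : Fin d → ZMod L)) =
      timeHolonomy V ((n + 1) + (n + 1)) (0, 0) := by
    congr 1; ring
  rw [h, timeHolonomy_add, zero_add]

/-- **The Polyakov loop splits across the reflection (even period)**:
`ρ(g_{L_0}) = ρ(gfunE U)ᴴ ρ(gfunE θU)`. [folklore] -/
theorem rep_polyakovLine_even (hρu : ∀ g, ρ g ∈ Matrix.unitaryGroup (Fin N) ℂ)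
    (U : Config d (2 * n + 2) L G) :
    ρ (polyakovLine U 0) = star (ρ (gfunE U)) * ρ (gfunE (timeReflect U)) := by
  rw [← rep_inv_eq_star ρ hρu, ← map_mul, polyakovLine_zero_eq_even, gfunE_timeReflect]
  unfold gfunE
  rw [inv_inv]

variable [NeZero L]

/-- **The Wilson weight across the reflection (even period)**:
`e^{−S} = e^{A(U)} e^{A(θU)} e^{J_M (mag₀(U) + mag_{n+1}(U))}` for a unitary `ρ`. [folklore] -/
theorem weight_even (hρu : ∀ g, ρ g ∈ Matrix.unitaryGroup (Fin N) ℂ) (JE JM : ℝ)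
    (U : Config d (2 * n + 2) L G) :
    weight ρ JE JM U = Real.exp (posExponentE ρ JE JM U) * Real.exp (posExponentE ρ JE JM (timeReflect U)) *
      Real.exp (JM * (magSlice ρ 0 U + magSlice ρ ((n + 1 : ℕ) : ZMod (2 * n + 2)) U)) := by
  rw [weight, minusAction_eq_sum_slices, sum_zmod_even_split_elec, sum_zmod_even_split_neg,
    ← Real.exp_add, ← Real.exp_add]
  congr 1
  have he : ∀ j ∈ Finset.range (n + 1), elecSlice ρ (j : ZMod (2 * n + 2)) U +
      elecSlice ρ (-1 - (j : ZMod (2 * n + 2))) U =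
        elecSlice ρ (j : ZMod (2 * n + 2)) U + elecSlice ρ (j : ZMod (2 * n + 2)) (timeReflect U) := by
    intro j _
    rw [elecSlice_timeReflect ρ hρu]
  have hm : ∀ j ∈ Finset.range n, magSlice ρ ((j + 1 : ℕ) : ZMod (2 * n + 2)) U +
      magSlice ρ (-((j + 1 : ℕ) : ZMod (2 * n + 2))) U =
        magSlice ρ ((j + 1 : ℕ) : ZMod (2 * n + 2)) U +
          magSlice ρ ((j + 1 : ℕ) : ZMod (2 * n + 2)) (timeReflect U) := by
    intro j _
    rw [magSlice_timeReflect]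
  rw [Finset.sum_congr rfl he, Finset.sum_congr rfl hm, Finset.sum_add_distrib,
    Finset.sum_add_distrib]
  unfold posExponentE
  ring

/-- **The integrand is in reflection-positive form (even period).**
`(|tr ρ(g_{L_0})|² − 1) e^{−S} = Σ_{pq} g_{pq}(U) conj g_{pq}(θU)`. [folklore] -/
theorem integrand_eq_even (hρu : ∀ g, ρ g ∈ Matrix.unitaryGroup (Fin N) ℂ) (hN : N ≠ 0)
    (JE JM : ℝ) (U : Config d (2 * n + 2) L G) :
    (((‖(ρ (polyakovLine U 0)).trace‖ ^ 2 : ℝ) : ℂ) - 1) * (weight ρ JE JM U : ℂ) =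
      ∑ p : Fin N × Fin N, ∑ q : Fin N × Fin N,
        gobsE ρ JE JM p q U * conj (gobsE ρ JE JM p q (timeReflect U)) := by
  rw [rep_polyakovLine_even ρ hρu U,
    normSq_trace_sub_one_eq_sum (hρu (gfunE U)) (hρu (gfunE (timeReflect U))) hN,
    weight_even ρ hρu, Complex.ofReal_mul, Complex.ofReal_mul]
  have hM : (Real.exp (JM * (magSlice ρ 0 U + magSlice ρ ((n + 1 : ℕ) : ZMod (2 * n + 2)) U)) : ℂ) =
      (Real.exp (planeExponentE ρ JM U) : ℂ) * (Real.exp (planeExponentE ρ JM U) : ℂ) := by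
    rw [← Complex.ofReal_mul, ← Real.exp_add]
    unfold planeExponentE
    congr 1; push_cast; ring
  have hplane : planeExponentE ρ JM (timeReflect U) = planeExponentE ρ JM U := by
    unfold planeExponentE
    rw [magSlice_timeReflect, magSlice_timeReflect, neg_zero, neg_half]
  rw [hM, Finset.sum_mul]
  refine Finset.sum_congr rfl fun p _ => ?_
  rw [Finset.sum_mul]
  refine Finset.sum_congr rfl fun q _ => ?_
  simp only [gobsE, fcoef, map_mul, Complex.conj_ofReal, Complex.conj_conj, hplane]
  ring

/-! ### Continuity, bounds, dependence -/

/-- `gfunE` depends only on the positive block. [folklore] -/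
theorem dependsOn_gfunE : DependsOn (fun U : Config d (2 * n + 2) L G => gfunE U)
    ((evenPos d n L ∪ ∅ ∪ evenShared d n L : Finset _) : Set _) := by
  intro U V hUV
  simp only [gfunE]
  rw [timeHolonomy_congr (V := V) (n + 1) 0 0 fun j hj => hUV _ (Finset.mem_coe.2 ?_)]
  rw [zero_add]
  exact natCast_none_mem_union_even (n := n) (by omega) 0

/-- The positive-side exponent depends only on `P ∪ ∅ ∪ M`. [folklore] -/
theorem dependsOn_posExponentE (JE JM : ℝ) :
    DependsOn (fun U : Config d (2 * n + 2) L G => posExponentE ρ JE JM U)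
      ((evenPos d n L ∪ ∅ ∪ evenShared d n L : Finset _) : Set _) := by
  intro U V hUV
  simp only [posExponentE]
  rw [Finset.sum_congr rfl fun (j : ℕ) hj => elecSlice_congr_slice ρ (U := U) (V := V)
      (j : ZMod (2 * n + 2))
      (fun x i => hUV _ (Finset.mem_coe.2
        (natCast_some_mem_union_even (n := n) (by have := Finset.mem_range.1 hj; omega) x i)))
      (fun x i => hUV _ (Finset.mem_coe.2
        (natCast_add_one_some_mem_union_even (n := n) (by have := Finset.mem_range.1 hj; omega) x i)))
      (fun x => hUV _ (Finset.mem_coe.2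
        (natCast_none_mem_union_even (n := n) (by have := Finset.mem_range.1 hj; omega) x))),
    Finset.sum_congr rfl fun (j : ℕ) hj => magSlice_congr_slice ρ (U := U) (V := V) _
      (fun x i => hUV _ (Finset.mem_coe.2
        (natCast_some_mem_union_even (n := n) (by have := Finset.mem_range.1 hj; omega) x i)))]

/-- The plane exponent depends only on the shared block. [folklore] -/
theorem dependsOn_planeExponentE (JM : ℝ) :
    DependsOn (fun U : Config d (2 * n + 2) L G => planeExponentE ρ JM U)
      ((evenPos d n L ∪ ∅ ∪ evenShared d n L : Finset _) : Set _) := by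
  intro U V hUV
  simp only [planeExponentE]
  rw [magSlice_congr_slice ρ (U := U) (V := V) 0 fun x i => hUV _ (Finset.mem_coe.2
      (Finset.mem_union_right _ (mem_evenShared_zero x i))),
    magSlice_congr_slice ρ (U := U) (V := V) _ fun x i => hUV _ (Finset.mem_coe.2
      (Finset.mem_union_right _ (mem_evenShared_half x i)))]

/-- The observables `g_{pq}` depend only on `P ∪ ∅ ∪ M`. [folklore] -/
theorem dependsOn_gobsE (JE JM : ℝ) (p q : Fin N × Fin N) :
    DependsOn (gobsE ρ JE JM p q : Config d (2 * n + 2) L G → ℂ)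
      ((evenPos d n L ∪ ∅ ∪ evenShared d n L : Finset _) : Set _) := by
  intro U V hUV
  have h1 : gfunE U = gfunE V := dependsOn_gfunE hUV
  have h2 : posExponentE ρ JE JM U = posExponentE ρ JE JM V := dependsOn_posExponentE ρ JE JM hUV
  have h3 : planeExponentE ρ JM U = planeExponentE ρ JM V := dependsOn_planeExponentE ρ JM hUV
  simp only [gobsE]
  rw [h1, h2, h3]

variable [TopologicalSpace G] [IsTopologicalGroup G]

omit [NeZero L] in
/-- Continuity of `gfunE`. [folklore] -/
theorem continuous_gfunE : Continuous fun U : Config d (2 * n + 2) L G => gfunE U :=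
  (continuous_timeHolonomy (n + 1) _).inv

/-- Continuity of the observables `g_{pq}`. [folklore] -/
theorem continuous_gobsE (hρ : Continuous ρ) (JE JM : ℝ) (p q : Fin N × Fin N) :
    Continuous (gobsE ρ JE JM p q : Config d (2 * n + 2) L G → ℂ) := by
  unfold gobsE fcoef posExponentE planeExponentE
  refine ((Complex.continuous_conj.comp ?_).mul
    (Complex.continuous_ofReal.comp (Real.continuous_exp.comp ?_))).mul
    (Complex.continuous_ofReal.comp (Real.continuous_exp.comp ?_))
  · have hg : Continuous fun U : Config d (2 * n + 2) L G => ρ (gfunE U) := hρ.comp continuous_gfunE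
    exact ((hg.matrix_elem p.1 p.2).mul
      (Complex.continuous_conj.comp (hg.matrix_elem q.1 q.2))).sub continuous_const
  · exact (continuous_const.mul (continuous_finsetSum _ fun _ _ => continuous_elecSlice ρ hρ _)).add
      (continuous_const.mul (continuous_finsetSum _ fun _ _ => continuous_magSlice ρ hρ _))
  · exact (continuous_const.mul ((continuous_magSlice ρ hρ _).add (continuous_magSlice ρ hρ _))).div_const _

variable [CompactSpace G]

/-- The observables `g_{pq}` are uniformly bounded. [folklore] -/
theorem exists_forall_norm_gobsE_le (hρu : ∀ g, ρ g ∈ Matrix.unitaryGroup (Fin N) ℂ)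
    (hρ : Continuous ρ) (JE JM : ℝ) :
    ∃ K : ℝ, ∀ (p q : Fin N × Fin N) (U : Config d (2 * n + 2) L G), ‖gobsE ρ JE JM p q U‖ ≤ K := by
  have hc1 : Continuous fun U : Config d (2 * n + 2) L G => posExponentE ρ JE JM U :=
    (continuous_const.mul (continuous_finsetSum _ fun _ _ => continuous_elecSlice ρ hρ _)).add
      (continuous_const.mul (continuous_finsetSum _ fun _ _ => continuous_magSlice ρ hρ _))
  have hc2 : Continuous fun U : Config d (2 * n + 2) L G => planeExponentE ρ JM U :=
    (continuous_const.mul ((continuous_magSlice ρ hρ _).add (continuous_magSlice ρ hρ _))).div_const _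
  obtain ⟨K₁, hK₁⟩ := exists_forall_norm_le_of_continuous hc1
  obtain ⟨K₂, hK₂⟩ := exists_forall_norm_le_of_continuous hc2
  refine ⟨2 * Real.exp K₁ * Real.exp K₂, fun p q U => ?_⟩
  unfold gobsE
  rw [norm_mul, norm_mul, Complex.norm_conj, Complex.norm_real, Complex.norm_real,
    Real.norm_of_nonneg (Real.exp_pos _).le, Real.norm_of_nonneg (Real.exp_pos _).le]
  have h1 := norm_fcoef_le (hρu (gfunE U)) p q
  have h2 : Real.exp (posExponentE ρ JE JM U) ≤ Real.exp K₁ :=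
    Real.exp_le_exp.2 ((Real.le_norm_self _).trans (hK₁ U))
  have h3 : Real.exp (planeExponentE ρ JM U) ≤ Real.exp K₂ :=
    Real.exp_le_exp.2 ((Real.le_norm_self _).trans (hK₂ U))
  exact mul_le_mul (mul_le_mul h1 h2 (Real.exp_pos _).le (by norm_num)) h3 (Real.exp_pos _).le
    (by positivity)

end Even

/-! ### Reflection positivity of the Polyakov-loop sector: the even case -/

section EvenMain

variable {d n L : ℕ} [NeZero L] {G : Type*} [Group G] [TopologicalSpace G] [IsTopologicalGroup G]
  [CompactSpace G] [MeasurableSpace G] [BorelSpace G] [SecondCountableTopology G] {N : ℕ}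
variable (ρ : G →* Matrix (Fin N) (Fin N) ℂ)

omit [NeZero L] [TopologicalSpace G] [IsTopologicalGroup G] [CompactSpace G] [MeasurableSpace G]
  [BorelSpace G] [SecondCountableTopology G] in
/-- `mulOn ∅` is the identity. [folklore] -/
theorem mulOn_empty {L₀ : ℕ} (Y U : Config d L₀ L G) : mulOn ∅ Y U = U := by
  funext e; simp [mulOn]

omit [NeZero L] [TopologicalSpace G] [IsTopologicalGroup G] [CompactSpace G] [MeasurableSpace G]
  [BorelSpace G] [SecondCountableTopology G] [Group G] in
/-- `splice ∅ p = p.1`. [folklore] -/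
theorem splice_empty {L₀ : ℕ} (p : Config d L₀ L G × Config d L₀ L G) : splice ∅ p = p.1 := by
  funext e; rw [splice_apply, if_neg (Finset.notMem_empty e)]

/-- **Reflection positivity for the Polyakov-loop observable, even period** (`L₀ = 2n + 2`,
unitary continuous `ρ`, `N ≥ 1`): `0 ≤ ∫ (|tr ρ(g_{L_0})|² − 1) e^{−S} ∏dg` as a complex
number. [cite: BorgsSeiler1983, §III.1 (III.25) (p. 347)] -/
theorem integral_obs_mul_weight_nonneg_even (hρu : ∀ g, ρ g ∈ Matrix.unitaryGroup (Fin N) ℂ)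
    (hρ : Continuous ρ) (hN : N ≠ 0) (JE JM : ℝ) :
    0 ≤ ∫ U, ((((‖(ρ (polyakovLine U 0)).trace‖ ^ 2 : ℝ) : ℂ) - 1) * (weight ρ JE JM U : ℂ))
      ∂haar d (2 * n + 2) L G := by
  have hFc : Continuous fun U : Config d (2 * n + 2) L G =>
      ((((‖(ρ (polyakovLine U 0)).trace‖ ^ 2 : ℝ) : ℂ) - 1) * (weight ρ JE JM U : ℂ)) := by
    refine ((Complex.continuous_ofReal.comp ?_).sub continuous_const).mul
      (Complex.continuous_ofReal.comp (continuous_weight ρ hρ JE JM))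
    exact ((continuous_polyakovTrace ρ hρ 0).norm).pow 2
  obtain ⟨K, hK⟩ := exists_forall_norm_le_of_continuous hFc
  rw [integral_eq_integral_prod_mulOn ∅ hFc.measurable hK]
  simp_rw [mulOn_empty, integrand_eq_even ρ hρu hN JE JM]
  obtain ⟨Kg, hKg⟩ := exists_forall_norm_gobsE_le (d := d) (n := n) (L := L) ρ hρu hρ JE JM
  have hterm : ∀ p q : Fin N × Fin N, 0 ≤ ∫ z : (Config d (2 * n + 2) L G × Config d (2 * n + 2) L G),
      gobsE ρ JE JM p q (splice ∅ z) * conj (gobsE ρ JE JM p q (timeReflect z.1))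
        ∂(haar d (2 * n + 2) L G).prod (haar d (2 * n + 2) L G) :=
    fun p q => Literature.MathematicalPhysics.QuantumFieldTheory.LatticeRP.integral_splice_mul_conj_comp_of_shared_nonneg
      (haarProbability G) (evenShared d n L) (evenPos d n L) ∅ timeReflect
      measurePreserving_timeReflect (fun U e he => timeReflect_apply_of_mem_evenShared U he)
      (fun e he => dependsOn_timeReflect_apply_even he) disjoint_evenShared_evenPos
      (Finset.disjoint_empty_right _) (continuous_gobsE ρ hρ JE JM p q).measurable
      (fun U => hKg p q U) (dependsOn_gobsE ρ JE JM p q)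
  have hcont : ∀ p q : Fin N × Fin N, Continuous fun z : Config d (2 * n + 2) L G × Config d (2 * n + 2) L G =>
      gobsE ρ JE JM p q z.1 * conj (gobsE ρ JE JM p q (timeReflect z.1)) := fun p q =>
    ((continuous_gobsE ρ hρ JE JM p q).comp continuous_fst).mul
      (Complex.continuous_conj.comp ((continuous_gobsE ρ hρ JE JM p q).comp
        (continuous_timeReflect.comp continuous_fst)))
  have hint : ∀ p q : Fin N × Fin N, Integrable (fun z : Config d (2 * n + 2) L G × Config d (2 * n + 2) L G =>
      gobsE ρ JE JM p q z.1 * conj (gobsE ρ JE JM p q (timeReflect z.1)))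
      ((haar d (2 * n + 2) L G).prod (haar d (2 * n + 2) L G)) := fun p q =>
    (hcont p q).integrable_of_hasCompactSupport
      (IsCompact.of_isClosed_subset isCompact_univ (isClosed_tsupport _) (Set.subset_univ _))
  rw [integral_finsetSum _ fun p _ => integrable_finsetSum _ fun q _ => hint p q]
  refine Finset.sum_nonneg fun p _ => ?_
  rw [integral_finsetSum _ fun q _ => hint p q]
  refine Finset.sum_nonneg fun q _ => ?_
  have h := hterm p q
  simp_rw [splice_empty] at h
  exact h

/-- The same as a real integral. [cite: BorgsSeiler1983, §III.1 (III.25) (p. 347)] -/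
theorem integral_normSq_sub_one_mul_weight_nonneg_even
    (hρu : ∀ g, ρ g ∈ Matrix.unitaryGroup (Fin N) ℂ) (hρ : Continuous ρ) (hN : N ≠ 0) (JE JM : ℝ) :
    0 ≤ ∫ U, (‖(ρ (polyakovLine U 0)).trace‖ ^ 2 - 1) * weight ρ JE JM U ∂haar d (2 * n + 2) L G := by
  have h := integral_obs_mul_weight_nonneg_even (d := d) (n := n) (L := L) ρ hρu hρ hN JE JM
  have hcast : ∀ U : Config d (2 * n + 2) L G,
      ((((‖(ρ (polyakovLine U 0)).trace‖ ^ 2 : ℝ) : ℂ) - 1) * (weight ρ JE JM U : ℂ)) =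
        (((‖(ρ (polyakovLine U 0)).trace‖ ^ 2 - 1) * weight ρ JE JM U : ℝ) : ℂ) := fun U => by
    push_cast; ring
  simp_rw [hcast, integral_complex_ofReal] at h
  exact Complex.zero_le_real.1 h

/-- **Borgs–Seiler's diagonal bound, even temporal extent**: for `L₀ = 2n + 2` time layers, a
continuous unitary `N × N` matrix representation `ρ` (`N ≥ 1`) and any `J_E, J_M`,
`G_L(0) = ⟨|tr ρ(g_{L_0})|²⟩ ≥ 1`. [cite: BorgsSeiler1983, §III.1 (III.18), (III.23)–(III.25) (p. 347)] -/
theorem one_le_polyakovCorrelation_zero_even (hρu : ∀ g, ρ g ∈ Matrix.unitaryGroup (Fin N) ℂ)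
    (hρ : Continuous ρ) (hN : N ≠ 0) (JE JM : ℝ) :
    1 ≤ polyakovCorrelation (L₀ := 2 * n + 2) ρ JE JM (0 : Fin d → ZMod L) := by
  have hZ := partitionFunction_pos (d := d) (L₀ := 2 * n + 2) (L := L) ρ hρ JE JM
  have h0 := integral_normSq_sub_one_mul_weight_nonneg_even (d := d) (n := n) (L := L) ρ hρu hρ hN JE JM
  unfold polyakovCorrelation expectation
  rw [le_div_iff₀ hZ, one_mul]
  have hre : ∀ U : Config d (2 * n + 2) L G,
      (polyakovTrace ρ U 0 * conj (polyakovTrace ρ U 0)).re = ‖(ρ (polyakovLine U 0)).trace‖ ^ 2 := by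
    intro U
    rw [Complex.mul_conj, Complex.normSq_eq_norm_sq]
    norm_cast
  simp_rw [hre]
  have hw := integrable_of_continuous (d := d) (L₀ := 2 * n + 2) (L := L) (continuous_weight ρ hρ JE JM)
  have hf : Integrable (fun U : Config d (2 * n + 2) L G =>
      ‖(ρ (polyakovLine U 0)).trace‖ ^ 2 * weight ρ JE JM U) (haar d (2 * n + 2) L G) :=
    integrable_of_continuous ((((continuous_polyakovTrace ρ hρ 0)).norm.pow 2).mul
      (continuous_weight ρ hρ JE JM))
  have hsub : ∫ U, (‖(ρ (polyakovLine U 0)).trace‖ ^ 2 - 1) * weight ρ JE JM U ∂haar d (2 * n + 2) L G =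
      ∫ U, ‖(ρ (polyakovLine U 0)).trace‖ ^ 2 * weight ρ JE JM U ∂haar d (2 * n + 2) L G -
        ∫ U, weight ρ JE JM U ∂haar d (2 * n + 2) L G := by
    rw [← integral_sub hf hw]
    refine integral_congr_ae (ae_of_all _ fun U => ?_)
    ring
  linarith

end EvenMain

/-! ### All temporal extents; the discharge of `BorgsSeilerPolyakovDiagonal` -/

section AllExtents

variable {d L₀ L : ℕ} [NeZero L₀] [NeZero L] {G : Type*} [Group G] [TopologicalSpace G]
  [IsTopologicalGroup G] [CompactSpace G] [MeasurableSpace G] [BorelSpace G]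
  [SecondCountableTopology G] {N : ℕ}
variable (ρ : G →* Matrix (Fin N) (Fin N) ℂ)

/-- **Borgs–Seiler's diagonal bound `G_L(0) = ⟨|tr ρ(g_{L_0})|²⟩ ≥ 1` for every temporal extent
`L₀ ≥ 1`**, every continuous unitary `N × N` matrix representation `ρ` of a compact group
(`N ≥ 1`), `J_E ≥ 0` and any `J_M` (parity split between the odd and the even case).
[cite: BorgsSeiler1983, §III.1 (III.18), (III.23)–(III.25) (p. 347)] -/
theorem one_le_polyakovCorrelation_zero (hρu : ∀ g, ρ g ∈ Matrix.unitaryGroup (Fin N) ℂ)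
    (hρ : Continuous ρ) (hN : N ≠ 0) {JE : ℝ} (hJE : 0 ≤ JE) (JM : ℝ) :
    1 ≤ polyakovCorrelation (L₀ := L₀) ρ JE JM (0 : Fin d → ZMod L) := by
  obtain ⟨k, hk | hk⟩ := Nat.even_or_odd' L₀
  · obtain ⟨n, rfl⟩ : ∃ n, k = n + 1 := ⟨k - 1, by have := NeZero.ne L₀; omega⟩
    have hL : L₀ = 2 * n + 2 := by omega
    subst hL
    exact one_le_polyakovCorrelation_zero_even ρ hρu hρ hN JE JM
  · subst hk
    exact one_le_polyakovCorrelation_zero_odd ρ hρu hρ hN hJE JM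

end AllExtents

end FiniteTemperature

open FiniteTemperature Literature.MathematicalPhysics.QuantumLattice

/-- **Discharge of `BorgsSeilerPolyakovDiagonal`** — Borgs–Seiler's "easy bound" (III.23)
`G(0) = ⟨|Tr u|²⟩ ≥ 1` for the fundamental representations of `U(N)` (`N ≥ 1`) and `SU(N)`
(`N ≥ 2`), every space dimension `d`, every temporal extent `L₀ ≥ 1`, every even spatial box of
side `L ≥ 4` and all `J_E, J_M > 0` (`HasPolyakovDiagonalBound`), PROVED by reflection positivity
in the time direction: "(III.18) follows from the Clebsch–Gordan decomposition
`|Tr u|² = 1 + Σ cᵢχᵢ(u)` (III.25) … and the fact that by reflection positivity `⟨χᵢ(u)⟩ ≥ 0`".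
[cite: BorgsSeiler1983, §III.1 (III.18), (III.23)–(III.25) (p. 347)] -/
theorem BorgsSeilerPolyakovDiagonal_holds : BorgsSeilerPolyakovDiagonal := by
  refine ⟨fun N d L₀ _ hN L _ _ _ JE JM hJE _ => ?_, fun N d L₀ _ hN L _ _ _ JE JM hJE _ => ?_⟩
  · exact one_le_polyakovCorrelation_zero (unitaryFundamentalRep (Fin N) ℂ) (fun g => g.2)
      (continuous_unitaryFundamentalRep (Fin N) ℂ) (by omega) hJE.le JM
  · exact one_le_polyakovCorrelation_zero (fundamentalRep (Fin N)) fundamentalRep_mem_unitaryGroup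
      (continuous_fundamentalRep (Fin N)) (by omega) hJE.le JM

end Literature.Barriers.QuantumFields

end
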